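import Mathlib
import Summits.NavierStokesRegularity.NavierStokesRegularity.Theorems.LinearLiouvilleSeven.Negative.LinearLiouvilleSevenFalseOfGalileanNontrivial
import Literature.Analysis.FluidPDE.SpaceTimeCalculus
import HarnessLib

/-!
# Line `galilean-collapse` of item stmt-NavierStokesRegularity-4054 (`LinearLiouvilleSeven`):
# registered stubs B3 and B4

Route `SymmetryModuliCount`, sub-problem `NavierStokesRegularity`. The two remaining registered
Part-B stubs of the skeleton `Cruxes/LinearLiouvilleSeven/Lines/galilean-collapse.lean`, proved
VERBATIM (so that, together with B2a `stub_galileanModeRegular` p74637, B2b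
`stub_galileanModeMomentum` p75316, C1 `stub_anchorGradientCaloric` p74208 and A3
`stub_anchorAssembly`, every registered stub of the line except the transfer stub
`stub_typeIAncientLiouville` — the route target `X` itself — is a theorem):

* `stub_sevenIndependentModulations` (B3): seven tempered modulations whose nontrivial
  combinations are nonzero at times accumulating at every `t₀ < 0` — witness
  `φ_k = (1 − t)^{-(k+1)}` of the cdisprove seat (`phiMod`, `phiMod_isModulation`: smooth,
  `|φ|, √(−t)|φ′|, √(−t)³|φ″| ≤ (k+1)(k+2)`), whose total modulation `Σ cₖφₖ = P_c(g)`,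
  `P_c ≠ 0`, vanishes at finitely many times (`finite_zeroSet`), hence not on a whole interval;
* `stub_sliceConstantModesForceFlat` (B4): a slice-constant combination of the modes
  `φₖ′e − φₖ∂ₑu` with total modulation nonzero at a dense set of times forces `∂ₑu ≡ 0` —
  at a good time the slice `∂ₑu(t, ·)` is frozen (`fderiv_apply_const_of_sliceConstant`) and a
  bounded field with constant directional derivative has that derivative `0`
  (`dirDeriv_const_eq_zero`); good times accumulate everywhere and `t ↦ ∂ₑu(t, x)` is
  continuous (joint smoothness), so `∂ₑu(t, x) = 0` at every `t < 0`.

## References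

* G. Koch, N. Nadirashvili, G. Seregin, V. Šverák, Acta Math. 203 (2009), §1 [KNSS2009].
* Cruxes/LinearLiouvilleSeven/Lines/galilean-collapse.lean (skeleton, Part B).
-/

noncomputable section

set_option linter.dupNamespace false -- tree namespace `Summit.<S>.<S>.Theorems` (summit = sub-problem) trips the core linter under standalone elaboration; the lakefile sets it weakly

open Set Function Filter
open scoped Topology RealInnerProductSpace BigOperators

namespace Summit.NavierStokesRegularity.NavierStokesRegularity.Theorems

open Literature.Analysis.FluidPDE
open Summit.NavierStokesRegularity.NavierStokesRegularity.Theorems.LinearLiouvilleSeven.Negative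

/-- A finite set of reals misses a point of every nonempty open interval. -/
theorem partB_exists_mem_Ioo_not_mem {Z : Set ℝ} (hZ : Z.Finite) {a b : ℝ} (hab : a < b) :
    ∃ t ∈ Ioo a b, t ∉ Z := by
  obtain ⟨t, ht⟩ := ((Set.Ioo_infinite hab).sdiff hZ).nonempty
  exact ⟨t, ht.1, ht.2⟩

/-- **Registered stub B3 (`stub_sevenIndependentModulations`) of item
stmt-NavierStokesRegularity-4054, line `galilean-collapse`: seven independent tempered
modulations.** Witness `φ_k(t) = (1 − t)^{-(k+1)}` (`phiMod`): smooth on `t < 0` with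
`|φ_k|, √(−t)|φ_k′|, √(−t)³|φ_k″| ≤ (k+1)(k+2)` (`phiMod_isModulation`); for `c ≠ 0` the total
modulation `Σ cₖφₖ(t) = P_c((1−t)⁻¹)` with `P_c ≠ 0` of degree `≤ 7` vanishes at finitely many
times (`finite_zeroSet`), so every interval `(t₀ − ε, t₀)`, `t₀ < 0`, contains a time where it
is nonzero. -/
theorem stub_sevenIndependentModulations :
    ∃ φ : Fin 7 → ℝ → ℝ,
      (∀ k, ContDiffOn ℝ (⊤ : ℕ∞) (φ k) (Set.Iio 0) ∧
        ∃ M : ℝ, ∀ t < 0, |φ k t| ≤ M ∧ Real.sqrt (-t) * |deriv (φ k) t| ≤ M ∧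
          Real.sqrt (-t) ^ 3 * |iteratedDeriv 2 (φ k) t| ≤ M) ∧
      ∀ c : Fin 7 → ℝ, c ≠ 0 → ∀ t₀ < 0, ∀ ε > 0, ∃ t < 0, |t - t₀| < ε ∧ ∑ k, c k * φ k t ≠ 0 := by
  refine ⟨phiMod, fun k => ?_, fun c hc t₀ ht₀ ε hε => ?_⟩
  · obtain ⟨hs, M, hM⟩ := phiMod_isModulation k
    refine ⟨hs, M, fun t ht => ?_⟩
    obtain ⟨h1, h2, h3⟩ := hM t ht
    refine ⟨h1, h2, ?_⟩
    rwa [iteratedDeriv_succ, iteratedDeriv_one]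
  · obtain ⟨t, ht, htZ⟩ := partB_exists_mem_Ioo_not_mem (finite_zeroSet hc)
      (show t₀ - ε < t₀ by linarith)
    refine ⟨t, ht.2.trans ht₀, ?_, htZ⟩
    rw [abs_lt]
    exact ⟨by linarith [ht.1], by linarith [ht.2]⟩

/-- **Registered stub B4 (`stub_sliceConstantModesForceFlat`) of item
stmt-NavierStokesRegularity-4054, line `galilean-collapse`: a slice-constant modulated
combination forces flatness along `e`.** `Σ cₖ(φₖ′e − φₖ∂ₑu) = α(t)e − ψ(t)∂ₑu(t, ·)` with
`ψ = Σ cₖφₖ`; where `ψ(t) ≠ 0` the slice `∂ₑu(t, ·)` is a constant `m`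
(`fderiv_apply_const_of_sliceConstant`), and `θ ↦ u(t, θe)` is bounded (`‖u‖ ≤ C/√(−t)`) with
constant derivative `m`, so `m = 0` (`dirDeriv_const_eq_zero`); such `t` accumulate at every
`t < 0` and `t ↦ ∂ₑu(t, x)` is continuous (joint smoothness), hence `∂ₑu(t, x) = 0`
everywhere. Only smoothness and the Type-I bound are used. -/
theorem stub_sliceConstantModesForceFlat :
    ∀ (C : ℝ) (u : ℝ → EuclideanSpace ℝ (Fin 3) → EuclideanSpace ℝ (Fin 3)),
      ContDiffOn ℝ (⊤ : ℕ∞) (Function.uncurry u) (Set.Iio 0 ×ˢ Set.univ) →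
      Literature.Analysis.FluidPDE.HasTypeITimeDecay C u →
      ∀ (e : EuclideanSpace ℝ (Fin 3)) (φ : Fin 7 → ℝ → ℝ) (c : Fin 7 → ℝ),
        (∀ t₀ < 0, ∀ ε > 0, ∃ t < 0, |t - t₀| < ε ∧ ∑ k, c k * φ k t ≠ 0) →
        (∀ t < 0, ∃ b : EuclideanSpace ℝ (Fin 3), ∀ x,
          ∑ k, c k • (deriv (φ k) t • e - φ k t • fderiv ℝ (u t) x e) = b) →
        ∀ t < 0, ∀ x, fderiv ℝ (u t) x e = 0 := by
  intro C u hu hTI e φ c hdense hconst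
  have huS : IsSmoothSpaceTimeOn (Iio 0) u := hu
  -- at a good time (total modulation nonzero) the directional derivative vanishes identically
  have hgood : ∀ s < 0, ∑ k, c k * φ k s ≠ 0 → ∀ x, fderiv ℝ (u s) x e = 0 := by
    intro s hs hψ x
    have hdiff : Differentiable ℝ (u s) := (huS.contDiff_slice hs).differentiable (by simp)
    have hfro : ∀ y, fderiv ℝ (u s) y e = fderiv ℝ (u s) 0 e := fun y =>
      fderiv_apply_const_of_sliceConstant (u := u) (e := e) (φ := φ) (c := c) (t := s)
        (by simpa only [galMode] using hconst s hs) hψ y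
    have hm : fderiv ℝ (u s) 0 e = 0 :=
      dirDeriv_const_eq_zero hdiff hfro (fun y => hTI s hs y)
    rw [hfro x, hm]
  -- continuity of `s ↦ ∂ₑu(s, x)` at every `t < 0` and density of good times
  intro t ht x
  have hcont : ContinuousAt (fun s => fderiv ℝ (u s) x e) t :=
    (((huS.isSmoothSpaceTimeOn_fderiv_apply isOpen_Iio e).differentiableWithinAt_time ht
      x).differentiableAt (Iio_mem_nhds ht)).continuousAt
  by_contra hne
  have hev : ∀ᶠ s in 𝓝 t, fderiv ℝ (u s) x e ≠ 0 := hcont.eventually_ne hne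
  obtain ⟨ε, hε, hball⟩ := Metric.eventually_nhds_iff.1 hev
  obtain ⟨s, hs, hst, hψ⟩ := hdense t ht ε hε
  exact hball (by rwa [Real.dist_eq]) (hgood s hs hψ x)

end Summit.NavierStokesRegularity.NavierStokesRegularity.Theorems

end
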